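import Mathlib
import Literature.Combinatorics.Optimization.DeKlerkPasechnikTheta
import HarnessLib

/-!
# Weak duality for `ϑ^{(0)}(G)` (Schrijver's `ϑ'`) and the 5-cycle at order 0

The order-0 cone of Parrilo's hierarchy is `K^{(0)}_n = PSD_n + N_n`
(`ParriloCopositiveSos.inParriloCone_zero_iff`), whose dual cone is the doubly nonnegative cone
`PSD_n ∩ N_n`; accordingly de Klerk–Pasechnik's order-0 bound `ϑ^{(0)}(G) = inf {t : t(I + A_G) - J
∈ K^{(0)}_n}` (`DeKlerkPasechnikTheta.theta G 0`) coincides with Schrijver's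
`ϑ'(G) = max {⟨J, X⟩ : Tr X = 1, X_{ij} = 0 (ij ∈ E), X ⪰ 0, X ≥ 0}`
[cite: LaurentVargas2022, §1 ((1.4)–(1.5); "ϑ^{(0)}(G) coincides with ϑ'(G)" [dKP2002])]
[cite: DeklerkPasechnik2002, §4]. This file proves the weak-duality half of that statement and uses
it, together with an explicit primal certificate, to pin down the order-0 level for the 5-cycle.

## Main statements

* `pairing_nonneg_of_posSemidef`: `⟨P, Y⟩ = ∑ P_{ij} Y_{ij} ≥ 0` for `P, Y ⪰ 0` (self-duality of
  `PSD_n`, easy half, via Mathlib's Schur product theorem) [cite: Laurent2008, §1.1];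
  `pairing_nonneg_of_inParriloCone_zero`: `K^{(0)}_n` pairs nonnegatively with doubly nonnegative
  matrices [cite: Gvozdenovic2008, §4.2.1 and Prop 4.2.6].
* `pairing_le_of_inParriloCone_zero_dkpMatrix`, `pairing_le_theta_zero` (**weak duality**): every
  `ϑ'`-feasible `X` (`X ⪰ 0`, `X ≥ 0`, `X_{ij} = 0` on `E`, `Tr X = 1`) satisfies
  `⟨J, X⟩ ≤ ϑ^{(0)}(G)` [cite: LaurentVargas2022, §1].
* **The 5-cycle** [cite: LaurentVargas2022, §1 ("the cycle C_5 has α(C_5) = 2 and ϑ-rank 1")]: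
  `indepNum_cycleGraph_five` (`α(C₅) = 2`); the dual witness `X = (34·I + 21·A_{C̄₅})/170`
  (a Fibonacci approximation of Lovász's umbrella) gives `theta_zero_cycleGraph_five_ge`
  (`ϑ^{(0)}(C₅) ≥ 38/17 = 2.2352…`, true value `√5 = 2.2360…`), hence
  `indepNum_lt_theta_zero_cycleGraph_five` (`ϑ^{(0)}(C₅) > α(C₅)`: the `ϑ`-rank of `C₅` is `≥ 1`,
  complementing `DeKlerkPasechnikTheta.not_inParriloCone_zero_dkpMatrix_cycleGraph_five`); the primal
  certificate `(5/2)(I + A_{C₅}) - J = P + A_{C₅}` with an explicit `P ⪰ 0`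
  (`inParriloCone_zero_dkpMatrix_cycleGraph_five`) gives `theta_zero_cycleGraph_five_le`
  (`ϑ^{(0)}(C₅) ≤ 5/2`) and `floor_theta_zero_cycleGraph_five` (`⌊ϑ^{(0)}(C₅)⌋ = α(C₅)`:
  rounding is exact for `C₅` already at order 0, before the general guarantee
  `DeKlerkPasechnikTheta.floor_theta_eq_indepNum`, which starts at order `α² - 1 = 3`).

All positive-semidefiniteness claims about the explicit `5 × 5` matrices are certified by rational
`LDLᵀ` (sum-of-squares) identities checked by `ring`.

## Not treated

Strong duality `ϑ^{(0)}(G) = ϑ'(G)` (attainment and the absence of a duality gap), the exact values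
`ϑ'(C₅) = ϑ(C₅) = √5` and `ϑ^{(1)}(C₅) = 2`.
-/

noncomputable section

namespace Literature.Combinatorics.Optimization.DeKlerkPasechnikThetaDual

open Matrix Finset SimpleGraph
open scoped Matrix
open Literature.Algebra.Polynomial.ParriloCopositiveSos
open Literature.Combinatorics.Optimization.MotzkinStrausCopositive
open Literature.Combinatorics.Optimization.DeKlerkPasechnikTheta

variable {V : Type*} [Fintype V]

/-! ## Pairing `K^{(0)}_n` against doubly nonnegative matrices -/

section Pairing

/-- **The cone `PSD_n` is self-dual (easy half)** [cite: Laurent2008, §1.1 ("the cone PSD_n is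
self-dual": `⟨A, B⟩ = Tr(AᵀB) = ∑ a_{ij} b_{ij} ≥ 0` for `A, B ⪰ 0`)]: here from the Schur product
theorem (`Matrix.PosSemidef.hadamard`), `⟨P, Y⟩ = 𝟙ᵀ (P ∘ Y) 𝟙 ≥ 0` (the trace form and the
full self-duality inside a matrix `*`-algebra are
`Literature.Analysis.Convex.MatrixStarAlgebraPSD.posSemidef_iff_forall_mem_trace_mul_nonneg`). -/
theorem pairing_nonneg_of_posSemidef {P Y : Matrix V V ℝ} (hP : P.PosSemidef) (hY : Y.PosSemidef) :
    0 ≤ ∑ i, ∑ j, P i j * Y i j := by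
  have h := (hP.hadamard hY).dotProduct_mulVec_nonneg fun _ => 1
  simpa [dotProduct, Matrix.mulVec, Matrix.hadamard] using h

/-- **`K^{(0)}_n = PSD_n + N_n` pairs nonnegatively with the doubly nonnegative cone `PSD_n ∩ N_n`**
(weak duality for Parrilo's order-0 cone) [cite: Gvozdenovic2008, §4.2.1 (K^{(0)}_n = {P + N}) with
Prop 4.2.6 (the dual cones C^{(t)}_n = (K^{(t)}_n)^*)] [cite: Laurent2008, §1.1]. -/
theorem pairing_nonneg_of_inParriloCone_zero {M Y : Matrix V V ℝ} (hM : Mᵀ = M)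
    (h : InParriloCone 0 M) (hY : Y.PosSemidef) (hY' : ∀ i j, 0 ≤ Y i j) :
    0 ≤ ∑ i, ∑ j, M i j * Y i j := by
  classical
  obtain ⟨P, N, hP, hN, -, rfl⟩ := exists_posSemidef_add_nonneg_of_inParriloCone_zero hM h
  simp only [Matrix.add_apply, add_mul, Finset.sum_add_distrib]
  exact add_nonneg (pairing_nonneg_of_posSemidef hP hY)
    (Finset.sum_nonneg fun i _ => Finset.sum_nonneg fun j _ => mul_nonneg (hN i j) (hY' i j))

end Pairing

/-! ## `ϑ'`-feasible matrices bound `ϑ^{(0)}(G)` from below -/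

section ThetaPrime

variable [DecidableEq V] (G : SimpleGraph V) [DecidableRel G.Adj]

omit [Fintype V] in
/-- `t(I + A_G) - J` is symmetric. [folklore] -/
@[folklore] private theorem dkpMatrix_transpose' (t : ℝ) : (dkpMatrix G t)ᵀ = dkpMatrix G t := by
  have hJ : (onesMatrix : Matrix V V ℝ)ᵀ = onesMatrix := by ext; rfl
  rw [dkpMatrix, msMatrix, transpose_sub, transpose_smul, transpose_add, transpose_one,
    SimpleGraph.transpose_adjMatrix, hJ]

omit [Fintype V] in
/-- Entries of `t(I + A_G) - J`. [folklore] -/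
@[folklore] private theorem dkpMatrix_apply' (t : ℝ) (i j : V) :
    dkpMatrix G t i j = t * ((if i = j then 1 else 0) + if G.Adj i j then 1 else 0) - 1 := by
  simp only [dkpMatrix, msMatrix, onesMatrix, Matrix.sub_apply, Matrix.smul_apply, Matrix.add_apply,
    Matrix.one_apply, SimpleGraph.adjMatrix_apply, Matrix.of_apply, smul_eq_mul]

/-- The pairing `⟨t(I + A_G) - J, Y⟩` for a matrix `Y` vanishing on the edges of `G` equals
`t · Tr Y - ⟨J, Y⟩`. [folklore] -/
@[folklore] private theorem pairing_dkpMatrix {t : ℝ} {Y : Matrix V V ℝ}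
    (hE : ∀ i j, G.Adj i j → Y i j = 0) :
    ∑ i, ∑ j, dkpMatrix G t i j * Y i j = t * ∑ i, Y i i - ∑ i, ∑ j, Y i j := by
  have hterm : ∀ i j, dkpMatrix G t i j * Y i j = (if i = j then t * Y i j else 0) - Y i j := by
    intro i j
    simp only [dkpMatrix, msMatrix, onesMatrix, Matrix.sub_apply, Matrix.smul_apply, Matrix.add_apply,
      Matrix.one_apply, SimpleGraph.adjMatrix_apply, Matrix.of_apply, smul_eq_mul]
    by_cases hij : i = j
    · subst hij; simp [sub_mul]
    · by_cases hadj : G.Adj i j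
      · rw [if_neg hij, if_pos hadj, if_neg hij, hE i j hadj]; ring
      · rw [if_neg hij, if_neg hadj, if_neg hij]; ring
  simp only [hterm, Finset.sum_sub_distrib, Finset.sum_ite_eq, Finset.mem_univ, if_true,
    Finset.mul_sum]

/-- **Weak duality between `ϑ^{(0)}` and Schrijver's `ϑ'`** [cite: LaurentVargas2022, §1 ((1.4):
`ϑ'(G) = max {⟨J, X⟩ : Tr X = 1, X_{ij} = 0 (ij ∈ E), X ⪰ 0, X ≥ 0}` and `ϑ^{(0)}(G) = ϑ'(G)`
[dKP2002])] [cite: DeklerkPasechnik2002, §4]: if `t(I + A_G) - J ∈ K^{(0)}_n` and `X` is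
`ϑ'`-feasible up to scaling (`X ⪰ 0`, `X ≥ 0`, `X_{ij} = 0` on edges), then `⟨J, X⟩ ≤ t · Tr X`. -/
theorem pairing_le_of_inParriloCone_zero_dkpMatrix {t : ℝ} (h : InParriloCone 0 (dkpMatrix G t))
    {X : Matrix V V ℝ} (hX : X.PosSemidef) (hX' : ∀ i j, 0 ≤ X i j)
    (hE : ∀ i j, G.Adj i j → X i j = 0) :
    ∑ i, ∑ j, X i j ≤ t * ∑ i, X i i := by
  have h0 := pairing_nonneg_of_inParriloCone_zero (dkpMatrix_transpose' G t) h hX hX'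
  rw [pairing_dkpMatrix G hE] at h0
  linarith

/-- **`ϑ'`-feasible matrices bound the whole hierarchy's order-0 level from below**
[cite: LaurentVargas2022, §1 ((1.4)–(1.5), ϑ^{(0)}(G) = ϑ'(G))] [cite: DeklerkPasechnik2002, §4]:
if `X ⪰ 0`, `X ≥ 0`, `X_{ij} = 0` on the edges and `Tr X = 1`, then `⟨J, X⟩ ≤ ϑ^{(0)}(G)`. -/
theorem pairing_le_theta_zero [Nonempty V] {X : Matrix V V ℝ} (hX : X.PosSemidef)
    (hX' : ∀ i j, 0 ≤ X i j) (hE : ∀ i j, G.Adj i j → X i j = 0) (htr : ∑ i, X i i = 1) :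
    ∑ i, ∑ j, X i j ≤ theta G 0 := by
  refine le_csInf ⟨_, inParriloCone_dkpMatrix_card G 0⟩ fun t ht => ?_
  have := pairing_le_of_inParriloCone_zero_dkpMatrix G ht hX hX' hE
  rwa [htr, mul_one] at this

end ThetaPrime

/-! ## The 5-cycle: `ϑ^{(0)}(C₅) > α(C₅)` -/

section FiveCycle

/-- **`α(C₅) = 2`** [cite: LaurentVargas2022, §1 ("the cycle C_5 has α(C_5) = 2")]. -/
theorem indepNum_cycleGraph_five : (cycleGraph 5).indepNum = 2 := by
  apply le_antisymm
  · obtain ⟨s, hs⟩ := (cycleGraph 5).exists_isNIndepSet_indepNum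
    rw [SimpleGraph.isNIndepSet_iff] at hs
    by_contra hlt
    obtain ⟨u, hus, huc⟩ := Finset.exists_subset_card_eq (s := s) (n := 3) (by rw [hs.2]; omega)
    have hind : (cycleGraph 5).IsIndepSet ↑u := Set.Pairwise.mono (Finset.coe_subset.2 hus) hs.1
    have key : ∀ u : Finset (Fin 5), u.card = 3 → ¬ (cycleGraph 5).IsIndepSet ↑u := by decide
    exact key u huc hind
  · have h := SimpleGraph.IsIndepSet.card_le_indepNum (G := cycleGraph 5) (t := {0, 2}) (by decide)
    simpa using h

/-- A rational near-optimal `ϑ'`-feasible matrix for `C₅`: `X = (34·I + 21·A_{C̄₅}) / 170`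
(a Fibonacci approximation `34/21` of the golden ratio appearing in Lovász's umbrella; the optimum
gives `ϑ'(C₅) = ϑ(C₅) = √5`). [folklore] -/
@[folklore] private def c5Witness : Matrix (Fin 5) (Fin 5) ℝ :=
  !![34/170, 0, 21/170, 21/170, 0;
     0, 34/170, 0, 21/170, 21/170;
     21/170, 0, 34/170, 0, 21/170;
     21/170, 21/170, 0, 34/170, 0;
     0, 21/170, 21/170, 0, 34/170]

/-- `X ⪰ 0`, by an explicit rational `LDLᵀ` (sum of squares) certificate for `34·I + 21·A_{C̄₅}`.
[folklore] -/
@[folklore] private theorem c5Witness_posSemidef : c5Witness.PosSemidef := by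
  refine PosSemidef.of_dotProduct_mulVec_nonneg ?_ fun x => ?_
  · unfold Matrix.IsHermitian
    ext i j
    simp only [conjTranspose_apply, star_trivial]
    fin_cases i <;> fin_cases j <;> simp [c5Witness]
  · have hq : star x ⬝ᵥ c5Witness *ᵥ x = (1 / 170 : ℝ) *
        ((34 : ℝ) * (x 0 + 21 / 34 * x 2 + 21 / 34 * x 3) ^ 2
          + 34 * (x 1 + 21 / 34 * x 3 + 21 / 34 * x 4) ^ 2
          + 715 / 34 * (x 2 - 441 / 715 * x 3 + 714 / 715 * x 4) ^ 2
          + 1429 / 24310 * (x 3 - 441 / 1429 * x 4) ^ 2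
          + 76 / 1429 * x 4 ^ 2) := by
      simp [dotProduct, Matrix.mulVec, Fin.sum_univ_five, c5Witness]
      ring
    rw [hq]
    positivity

/-- `X ≥ 0` entrywise. [folklore] -/
@[folklore] private theorem c5Witness_nonneg (i j : Fin 5) : 0 ≤ c5Witness i j := by
  fin_cases i <;> fin_cases j <;> norm_num [c5Witness]

/-- `X` vanishes on the edges of `C₅` (it is supported on the pentagram `C̄₅` and the diagonal).
[folklore] -/
@[folklore] private theorem c5Witness_edges (i j : Fin 5) (h : (cycleGraph 5).Adj i j) :
    c5Witness i j = 0 := by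
  revert h
  fin_cases i <;> fin_cases j <;>
    first | (intro h; exact absurd h (by decide)) | (intro; simp [c5Witness])

/-- `Tr X = 1`. [folklore] -/
@[folklore] private theorem c5Witness_trace : ∑ i, c5Witness i i = 1 := by
  simp [Fin.sum_univ_five, c5Witness]; norm_num

/-- `⟨J, X⟩ = 38/17`. [folklore] -/
@[folklore] private theorem c5Witness_sum : ∑ i, ∑ j, c5Witness i j = 38 / 17 := by
  simp [Fin.sum_univ_five, c5Witness]; norm_num

/-- **A rational lower bound `ϑ^{(0)}(C₅) ≥ 38/17 = 2.235…`** (the true value is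
`ϑ^{(0)}(C₅) = ϑ'(C₅) = √5 = 2.236…`) [cite: LaurentVargas2022, §1 ((1.4), ϑ^{(0)} = ϑ')]
[cite: DeklerkPasechnik2002, §4]: from the `ϑ'`-feasible matrix `(34·I + 21·A_{C̄₅})/170`. -/
theorem theta_zero_cycleGraph_five_ge : (38 / 17 : ℝ) ≤ theta (cycleGraph 5) 0 := by
  rw [← c5Witness_sum]
  exact pairing_le_theta_zero (cycleGraph 5) c5Witness_posSemidef c5Witness_nonneg c5Witness_edges
    c5Witness_trace

/-- **The 5-cycle has `ϑ`-rank at least 1: `ϑ^{(0)}(C₅) > α(C₅)`** [cite: LaurentVargas2022, §1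
("the cycle C_5 has α(C_5) = 2 and ϑ-rank(C_5) = 1")] [cite: DeklerkPasechnik2002, §4]. -/
theorem indepNum_lt_theta_zero_cycleGraph_five :
    ((cycleGraph 5).indepNum : ℝ) < theta (cycleGraph 5) 0 := by
  rw [indepNum_cycleGraph_five]
  have := theta_zero_cycleGraph_five_ge
  push_cast
  linarith


/-- An explicit order-0 certificate for `C₅` at `t = 5/2`: the PSD part
`P = (5/2)(I + A_{C₅}) - J - N` with `N = A_{C₅}` (entries `3/2` on the diagonal, `1/2` on the
edges, `-1` on the pentagram). [folklore] -/
@[folklore] private def c5P : Matrix (Fin 5) (Fin 5) ℝ :=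
  !![3/2, 1/2, -1, -1, 1/2;
     1/2, 3/2, 1/2, -1, -1;
     -1, 1/2, 3/2, 1/2, -1;
     -1, -1, 1/2, 3/2, 1/2;
     1/2, -1, -1, 1/2, 3/2]

/-- The nonnegative part `N = A_{C₅}` of the order-0 certificate at `t = 5/2`. [folklore] -/
@[folklore] private def c5N : Matrix (Fin 5) (Fin 5) ℝ :=
  !![0, 1, 0, 0, 1;
     1, 0, 1, 0, 0;
     0, 1, 0, 1, 0;
     0, 0, 1, 0, 1;
     1, 0, 0, 1, 0]

/-- `P ⪰ 0` by an explicit rational `LDLᵀ` certificate. [folklore] -/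
@[folklore] private theorem c5P_posSemidef : c5P.PosSemidef := by
  refine PosSemidef.of_dotProduct_mulVec_nonneg ?_ fun x => ?_
  · unfold Matrix.IsHermitian
    ext i j
    simp only [conjTranspose_apply, star_trivial]
    fin_cases i <;> fin_cases j <;> simp [c5P]
  · have hq : star x ⬝ᵥ c5P *ᵥ x =
        (3 / 2 : ℝ) * (x 0 + 1 / 3 * x 1 - 2 / 3 * x 2 - 2 / 3 * x 3 + 1 / 3 * x 4) ^ 2
          + 4 / 3 * (x 1 + 5 / 8 * x 2 - 1 / 2 * x 3 - 7 / 8 * x 4) ^ 2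
          + 5 / 16 * (x 2 + 4 / 5 * x 3 + 1 / 5 * x 4) ^ 2
          + 3 / 10 * (x 3 + 2 / 3 * x 4) ^ 2 + 1 / 6 * x 4 ^ 2 := by
      simp [dotProduct, Matrix.mulVec, Fin.sum_univ_five, c5P]
      ring
    rw [hq]
    positivity

/-- `N ≥ 0`. [folklore] -/
@[folklore] private theorem c5N_nonneg (i j : Fin 5) : 0 ≤ c5N i j := by
  fin_cases i <;> fin_cases j <;> norm_num [c5N]

/-- `(5/2)(I + A_{C₅}) - J = P + N`. [folklore] -/
@[folklore] private theorem dkpMatrix_cycleGraph_five_eq : dkpMatrix (cycleGraph 5) (5 / 2) = c5P + c5N := by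
  ext i j
  rw [dkpMatrix_apply', Matrix.add_apply]
  fin_cases i <;> fin_cases j <;> simp +decide [c5P, c5N] <;> norm_num

/-- **An order-0 certificate for `C₅` at `t = 5/2`**: `(5/2)(I + A_{C₅}) - J ∈ PSD_5 + N_5 = K^{(0)}_5`
[cite: LaurentVargas2022, §1 (ϑ^{(0)} = ϑ', and ϑ'(C_5) ≤ ϑ(C_5) = √5 < 5/2)]
[cite: Laurent2008, Example 3.24]. -/
theorem inParriloCone_zero_dkpMatrix_cycleGraph_five :
    InParriloCone 0 (dkpMatrix (cycleGraph 5) (5 / 2)) :=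
  inParriloCone_zero_of_posSemidef_add_nonneg c5P_posSemidef c5N_nonneg dkpMatrix_cycleGraph_five_eq

/-- **`ϑ^{(0)}(C₅) ≤ 5/2`** [cite: LaurentVargas2022, §1] — so `38/17 ≤ ϑ^{(0)}(C₅) ≤ 5/2`
brackets the true value `√5`. -/
theorem theta_zero_cycleGraph_five_le : theta (cycleGraph 5) 0 ≤ 5 / 2 :=
  theta_le_of_inParriloCone (cycleGraph 5) inParriloCone_zero_dkpMatrix_cycleGraph_five

/-- **Rounding is already exact at order 0 for `C₅`**: `⌊ϑ^{(0)}(C₅)⌋ = 2 = α(C₅)`, although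
`C₅` has `ϑ`-rank 1 and the general guarantee `floor_theta_eq_indepNum` only starts at order
`α² - 1 = 3` [cite: LaurentVargas2022, §1] [cite: Gvozdenovic2008, Thm 4.2.10]. -/
theorem floor_theta_zero_cycleGraph_five : ⌊theta (cycleGraph 5) 0⌋₊ = (cycleGraph 5).indepNum := by
  have h1 := theta_zero_cycleGraph_five_ge
  have h2 := theta_zero_cycleGraph_five_le
  rw [indepNum_cycleGraph_five, Nat.floor_eq_iff (by linarith)]
  constructor <;> push_cast <;> linarith

end FiveCycle

end Literature.Combinatorics.Optimization.DeKlerkPasechnikThetaDual
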